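import Summits.ResolutionOfSingularities.ResolutionOfSingularities.Theorems.EquisingularLiftEquisingularLiftNatTowerPtRamMember
import Summits.ResolutionOfSingularities.ResolutionOfSingularities.Theorems.EquisingularLiftEquisingularLiftNatTowerInvDefs
import Summits.ResolutionOfSingularities.ResolutionOfSingularities.Theorems.EquisingularLiftEquisingularLiftNatExactShadowPlanar
import Summits.ResolutionOfSingularities.ResolutionOfSingularities.Theorems.EquisingularLiftEquisingularLiftNatStrictTransformOffCentre
import HarnessLib

/-!
# [OURS · L1 W4.5(b) · EL♮(3)] Rung TOWER₀, brick `towerPtRam_brick` part 3 — THE (pt-ram) STEP ON THE TOWER INVARIANT `Tower.Inv₁`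
# (res-D-pv-029's …NatTowerInvDefs): conclusion (I) `E ↦ υ₂⁻¹{y}` UNCONDITIONALLY, conclusion (II) `E ↦ closure υ₂⁻¹(E ∖ {y})` under the
# RULING-5 / (F5) couplings «`NoRound ∨ y ∉ E`», «`K = ∅ ∨ y ∉ closure K`» (and the γ-forget variant `K ↦ ∅`)
# (crux `EquisingularLiftNatThree` = stmt-ResolutionOfSingularities-20148, parent `EquisingularLiftNat` = stmt-…-20038; registered stub
# `stub_elnat_ratTowerPointResolution`, upstairs debt HSUB′(ReachTower₀)₃, driver `hsub_reachTower_of_invariant` p549473)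

HONEST FRAMING. OURS (cell res-hironaka, crux chain w45b, slot W4.5(b)); NOT a statement of any manuscript; AI-written, weaker than expert
review. Helper `--supports stmt-ResolutionOfSingularities-20148 --as helper`; closes nothing; no `sorry`; standard axioms; DEF-FREE.
res-L1-w45b-stub-4, object `towerPtRam_brick` (res-L1-w45b-plan-1 NAMING 2026-08-27T16:37:19Z (a); res-D-pv-029 g8 16:49:44Z (a) / Defs
PATH-ANNOUNCE 17:30:45Z; my CLAUSE WORD 17:46:06Z). The `TowerPtRam₁ F₁₀ (Tower.Inv₁ …)` glue over this file follows res-L1-w45b-lead-2's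
`₁` re-cut of the constructor (RULING-5 γ-forget); against the CURRENT `TowerPtRam` (p541504) conclusion (I) is this file's
`Tower.inv₁_ptRam_new` verbatim and conclusion (II) is `Tower.inv₁_ptRam_transport` with its two coupling hypotheses.

WHAT. In the binders of the driver prefix (DVR `O` complete with algebraically closed residue field, `θ : O ↠ k`, `q : P → Spec O` proper
smooth of relative dimension `n`, `P` integral regular locally Noetherian, `Y` closed irreducible in the special fibre, a stage predicate `Ch`
refining `Split.Chain` and closed under horizontal E1 steps) and of `TowerPtRam` (a tower stage `(G, γ, T, E, K)` with
`Tower.Inv₁ … Ruled F₉ Z₉ hZ₉ F₁₀ υ' G γ T E K`, a point `y` of `V(closure T)_red` at which it is NOT regular, the curvilinear fat point `J`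
at `y` — `supp J = {y}`, `J_y = (ℓ)`, `ℓ` cotangent-independent — and the blow-up `υ₂ : G′ → G` of `J`):
* `Tower.inv₁_ptRam_new` — **`Tower.Inv₁` at `(G′, υ₂ ≫ γ, closure υ₂⁻¹(T ∖ {y}), υ₂⁻¹{y}, closure υ₂⁻¹(K ∖ {y}))`**: the stage is part 2's
  `fatPointStep_model` (res-L1-w45b-stub-2's `fatPointStep` + bookkeeping), the new plane hosts no round (`Tower.NoRound`: it maps to ONE
  point of `F₉`), `T′ ⊄ υ₂⁻¹{y}` since `T ⊄ {y}`; the `Ch`-step's «off the generic point of `Y`» comes from `Split.Chain` alone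
  (`not_isGenericPoint_of_image_eq`: were `σ (jG y)` generic, the chain's fibre clause would force `S = {jG y}`, `T ⊆ {y}`).
* `Tower.inv₁_ptRam_transport` — **`Tower.Inv₁` at `(G′, υ₂ ≫ γ, closure υ₂⁻¹(T ∖ {y}), closure υ₂⁻¹(E ∖ {y}), closure υ₂⁻¹(K ∖ {y}))`**
  under «`Tower.NoRound υ' G γ E ∨ y ∉ E`» and «`K = ∅ ∨ y ∉ closure K`» and the TRANSPORT HYPOTHESIS for the ruled-surface parameter
  `Ruled` along a point step away from `E` (the interface `ruled_of_step_away` of res-D-pv-029's assembly, taken as a hypothesis in the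
  shape of my CLAUSE WORD): `𝓔 ↦ 𝓔·𝒪_{X″}`, `𝒦 ↦ 𝒦·𝒪_{X″}` by part 1 (E1)–(E4) (both miss the centre), (k-iii) flatness through the iso
  `V((𝓔 ⊔ 𝒦)·𝒪_{X″}) ≅ V(𝓔 ⊔ 𝒦)` over `τ`, (k-iv) conditional regularity through the stalk isomorphisms of `υ₂` / `τ` off the centres
  (`Tower.shadow_conditionalRegularity_transport`).
* `Tower.inv₁_ptRam_forget` — the same with the shadow FORGOTTEN (`K ↦ ∅`), under «`Tower.NoRound υ' G γ E ∨ y ∉ E`» only.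
NOT suppliable (res-D-pv-029 (F3)/(F5), by hand): (II) with `y ∈ E` for a round-ready `E`, and `K ↦ closure υ₂⁻¹(K ∖ {y})` with
`y ∈ closure K ≠ ∅` — the `₁` re-cut must not ask for them.

References: Q. Liu, *Algebraic Geometry and Arithmetic Curves* (2002), §8.1, Thm. 8.1.19 [Liu2002]; U. Görtz, T. Wedhorn, *Algebraic Geometry I*
(2020), Prop. 13.91 (3), (13.19) [GortzWedhorn2020]; The Stacks Project, Tags 02OS, 033B, 0805 [StacksProject] — through the cited tree files.
OURS planning texts (index only): res-D-pv-029 STATUS 16:31:11Z, 16:37:13Z, 16:49:44Z, 17:30:45Z; res-L1-w45b-plan-1 16:37:19Z (RULING-5).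
-/

set_option linter.dupNamespace false -- mandated namespace `Summit.<Summit>.<Problem>` of this single-conjunct summit
set_option linter.overlappingInstances false -- the binders carry `[IsDomain O] [IsDiscreteValuationRing O]`

noncomputable section

open CategoryTheory CategoryTheory.Limits AlgebraicGeometry TopologicalSpace Topology IsLocalRing
open Literature.AlgebraicGeometry.Resolution
open AlgebraicGeometry.Scheme.IdealSheafData
open Summit.ResolutionOfSingularities.ResolutionOfSingularities.Theses.EquisingularLift.Split
open Summit.ResolutionOfSingularities.ResolutionOfSingularities.Cruxes.EquisingularLift.StrataSplit

namespace Summit.ResolutionOfSingularities.ResolutionOfSingularities.Cruxes.EquisingularLiftNat.Sections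

/-! ## Inputs read off `Split.Chain` and the model square -/

/-- **«Off the generic point of `Y`» from the chain alone.** For a `Split.Chain` stage `(X, σ, S)`, an injective `jG : G → X` with
`jG '' T = S`, a point `y ∈ G` with `jG y` closed and `T ⊄ {y}`: `σ (jG y)` is not the generic point of `Y` (else the chain's fibre clause
`σ⁻¹{ξ} = {ξ′}`, `S = closure {ξ′}` forces `S = {jG y}` and `T ⊆ {y}`). [folklore over the route's `Chain.fibre`] -/
theorem not_isGenericPoint_of_image_eq {P X G : Scheme.{0}} {Y : Set P} {σ : X ⟶ P} {S : Set X} (hch : Chain P Y X σ S)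
    (jG : G ⟶ X) (hj : Function.Injective jG) {T : Set G} (hTS : jG '' T = S) {y : G} (hyc : IsClosed ({jG y} : Set X))
    (hTy : ¬ T ⊆ {y}) : ¬ IsGenericPoint (σ (jG y)) Y := by
  intro hgen
  obtain ⟨ξ', hfib, hS⟩ := Chain.fibre hch hgen
  have h1 : jG y = ξ' := by
    have h2 : jG y ∈ σ ⁻¹' {σ (jG y)} := rfl
    rw [hfib] at h2
    exact h2
  apply hTy
  intro t ht
  have h2 : jG t ∈ S := hTS ▸ ⟨t, ht, rfl⟩
  rw [hS, ← h1, hyc.closure_eq] at h2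
  exact hj h2

/-! ## (k-iv) CONDITIONAL REGULARITY is carried through a point step away from `E` and `closure K` -/

/-- **Transport of the shadow's conditional regularity (k-iv)** through a blow-up step whose centre `C` misses `V(𝓔)` and `V(𝒦)`, in a model
square `j₂ ≫ τ = υ₂ ≫ jG` over the blow-up `υ₂` of a centre supported at `pt ∉ E ∪ closure K`: the downstairs reducedness hypothesis at a point
`y₂` of `G′` is the one at `υ₂ y₂` (the reduced ideals of `E`, `closure K`, `E ∩ closure K` pull back reduced, `υ₂` is a stalk isomorphism
there), and the upstairs quotient stalk at `j₂ y₂` is the one at `jG (υ₂ y₂)` (`τ` is a stalk isomorphism off `V(C)`).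
[cite: GortzWedhorn2020, Prop. 13.91 (3) p. 414] [cite: StacksProject, Tag 033B] [OURS · L1 W4.5b · towerPtRam_brick] -/
theorem Tower.shadow_conditionalRegularity_transport {X X'' G G' : Scheme.{0}} [IsLocallyNoetherian X] [IsLocallyNoetherian X'']
    [IsLocallyNoetherian G] {τ : X'' ⟶ X} {C : X.IdealSheafData} (hτ : IsBlowup τ C) {jG : G ⟶ X} {j₂ : G' ⟶ X''}
    {υ₂ : G' ⟶ G} (hcomm : j₂ ≫ τ = υ₂ ≫ jG) {J : G.IdealSheafData} (hυ₂ : IsBlowup υ₂ J) {pt : G}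
    (hJsupp : (J.support : Set G) = {pt}) (𝓔 𝒦 : X.IdealSheafData)
    (hd𝓔 : Disjoint (𝓔.support : Set X) (C.support : Set X)) (hd𝒦 : Disjoint (𝒦.support : Set X) (C.support : Set X))
    {E K : Set G} (hEcl : IsClosed E) (hyE : pt ∉ E) (hyK : pt ∉ closure K)
    (hk2 : 𝒦.comap jG = vanishingIdeal (⟨closure K, isClosed_closure⟩ : Closeds G))
    (hk4 : ∀ y : G, jG y ∈ ((𝓔 ⊔ 𝒦).support : Set X) →
      stalkIdeal (vanishingIdeal (⟨E, hEcl⟩ : Closeds G) ⊔ vanishingIdeal (⟨closure K, isClosed_closure⟩ : Closeds G)) y =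
        stalkIdeal (vanishingIdeal (⟨E ∩ closure K, hEcl.inter isClosed_closure⟩ : Closeds G)) y →
      IsRegularLocalRing (X.presheaf.stalk (jG y) ⧸ stalkIdeal (𝓔 ⊔ 𝒦) (jG y)))
    (hE' : IsClosed (closure (υ₂ ⁻¹' (E \ {pt})))) :
    ∀ y₂ : G', j₂ y₂ ∈ ((𝓔.comap τ ⊔ 𝒦.comap τ).support : Set X'') →
      stalkIdeal (vanishingIdeal (⟨closure (υ₂ ⁻¹' (E \ {pt})), hE'⟩ : Closeds G') ⊔
          vanishingIdeal (⟨closure (closure (υ₂ ⁻¹' (K \ {pt}))), isClosed_closure⟩ : Closeds G')) y₂ =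
        stalkIdeal (vanishingIdeal (⟨closure (υ₂ ⁻¹' (E \ {pt})) ∩ closure (closure (υ₂ ⁻¹' (K \ {pt}))),
          hE'.inter isClosed_closure⟩ : Closeds G')) y₂ →
      IsRegularLocalRing (X''.presheaf.stalk (j₂ y₂) ⧸ stalkIdeal (𝓔.comap τ ⊔ 𝒦.comap τ) (j₂ y₂)) := by
  intro y₂ hy₂ hred₂
  -- the point downstairs and its images
  have hτj : τ (j₂ y₂) = jG (υ₂ y₂) := by rw [← Scheme.Hom.comp_apply, hcomm, Scheme.Hom.comp_apply]
  have hmem₁ : jG (υ₂ y₂) ∈ ((𝓔 ⊔ 𝒦).support : Set X) := by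
    rw [← Scheme.IdealSheafData.comap_sup, support_comap] at hy₂
    rw [← hτj]
    exact hy₂
  have hmem𝒦 : jG (υ₂ y₂) ∈ (𝒦.support : Set X) :=
    (Scheme.IdealSheafData.support_antitone (le_sup_right : 𝒦 ≤ 𝓔 ⊔ 𝒦)) hmem₁
  have hy₁K : υ₂ y₂ ∈ closure K := by
    have h1 : υ₂ y₂ ∈ ((𝒦.comap jG).support : Set G) := by rw [support_comap]; exact hmem𝒦
    rw [hk2, Scheme.IdealSheafData.coe_support_vanishingIdeal] at h1
    exact h1
  have hy₁J : υ₂ y₂ ∉ (J.support : Set G) := by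
    rw [hJsupp]
    rintro (h : υ₂ y₂ = pt)
    exact hyK (h ▸ hy₁K)
  have hz : τ (j₂ y₂) ∉ (C.support : Set X) := by
    rw [hτj]
    exact fun h => hd𝒦.le_bot ⟨hmem𝒦, h⟩
  -- the three reduced ideal sheaves of `E`, `closure K`, `E ∩ closure K` pull back to the reduced ones
  have hEeq : closure (υ₂ ⁻¹' (E \ {pt})) = υ₂ ⁻¹' E := by
    have h := preimage_eq_closure_preimage_diff_of_not_mem hυ₂ hJsupp E (by rwa [hEcl.closure_eq])
    rw [hEcl.closure_eq] at h
    exact h.symm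
  have hKeq : closure (closure (υ₂ ⁻¹' (K \ {pt}))) = υ₂ ⁻¹' closure K := by
    rw [closure_closure]
    exact (preimage_eq_closure_preimage_diff_of_not_mem hυ₂ hJsupp K hyK).symm
  have hdE : Disjoint ((⟨E, hEcl⟩ : Closeds G) : Set G) (J.support : Set G) := by
    rw [hJsupp]; exact Set.disjoint_singleton_right.mpr hyE
  have hdK : Disjoint ((⟨closure K, isClosed_closure⟩ : Closeds G) : Set G) (J.support : Set G) := by
    rw [hJsupp]; exact Set.disjoint_singleton_right.mpr hyK
  have hdEK : Disjoint ((⟨E ∩ closure K, hEcl.inter isClosed_closure⟩ : Closeds G) : Set G) (J.support : Set G) := by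
    rw [hJsupp]; exact Set.disjoint_singleton_right.mpr fun h => hyE h.1
  have hIE : vanishingIdeal (⟨closure (υ₂ ⁻¹' (E \ {pt})), hE'⟩ : Closeds G') =
      (vanishingIdeal (⟨E, hEcl⟩ : Closeds G)).comap υ₂ := by
    rw [hυ₂.comap_vanishingIdeal_of_disjoint _ hdE]
    congr 1
    exact Closeds.ext hEeq
  have hIK : vanishingIdeal (⟨closure (closure (υ₂ ⁻¹' (K \ {pt}))), isClosed_closure⟩ : Closeds G') =
      (vanishingIdeal (⟨closure K, isClosed_closure⟩ : Closeds G)).comap υ₂ := by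
    rw [hυ₂.comap_vanishingIdeal_of_disjoint _ hdK]
    congr 1
    exact Closeds.ext hKeq
  have hIEK : vanishingIdeal (⟨closure (υ₂ ⁻¹' (E \ {pt})) ∩ closure (closure (υ₂ ⁻¹' (K \ {pt}))),
      hE'.inter isClosed_closure⟩ : Closeds G') =
      (vanishingIdeal (⟨E ∩ closure K, hEcl.inter isClosed_closure⟩ : Closeds G)).comap υ₂ := by
    rw [hυ₂.comap_vanishingIdeal_of_disjoint _ hdEK]
    congr 1
    apply Closeds.ext
    change closure (υ₂ ⁻¹' (E \ {pt})) ∩ closure (closure (υ₂ ⁻¹' (K \ {pt}))) = υ₂ ⁻¹' (E ∩ closure K)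
    rw [hEeq, hKeq, Set.preimage_inter]
  -- the downstairs reducedness hypothesis descends along the stalk isomorphism of `υ₂` at `y₂`
  haveI : IsIso (υ₂.stalkMap y₂) := hυ₂.isIso_stalkMap_of_not_mem_support hy₁J
  have hbij : Function.Bijective (υ₂.stalkMap y₂).hom := ConcreteCategory.bijective_of_isIso (υ₂.stalkMap y₂)
  have hred₁ : stalkIdeal (vanishingIdeal (⟨E, hEcl⟩ : Closeds G) ⊔
      vanishingIdeal (⟨closure K, isClosed_closure⟩ : Closeds G)) (υ₂ y₂) =
      stalkIdeal (vanishingIdeal (⟨E ∩ closure K, hEcl.inter isClosed_closure⟩ : Closeds G)) (υ₂ y₂) := by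
    rw [hIE, hIK, hIEK, ← Scheme.IdealSheafData.comap_sup, stalkIdeal_comap_eq_map_stalkMap,
      stalkIdeal_comap_eq_map_stalkMap] at hred₂
    have h := congrArg (Ideal.comap (υ₂.stalkMap y₂).hom) hred₂
    rwa [Ideal.comap_map_of_bijective _ hbij, Ideal.comap_map_of_bijective _ hbij] at h
  -- conditional regularity downstairs-upstairs at `jG (υ₂ y₂)`, then across `τ`
  have hreg₁ := hk4 (υ₂ y₂) hmem₁ hred₁
  have hreg₂ := (isRegularLocalRing_quotient_carrierStrictTransform_of_not_mem_support hτ 𝓔 𝒦 hz (by rw [hτj]; exact hreg₁)).1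
  rwa [strictTransformIdeal_eq_comap_of_disjoint hτ 𝓔 hd𝓔, strictTransformIdeal_eq_comap_of_disjoint hτ 𝒦 hd𝒦] at hreg₂

/-! ## The (pt-ram) step on `Tower.Inv₁` -/

section PtRam

variable (O : Type) [CommRing O] [IsDomain O] [IsDiscreteValuationRing O] [IsAdicComplete (maximalIdeal O) O]
  [IsAlgClosed (ResidueField O)] (k : Type) [Field k] (θ : O →+* k) (hθ : Function.Surjective θ)
  (P : Scheme.{0}) (q : P ⟶ Spec (.of O)) (Y : Set P) (hYsp : Y ⊆ q ⁻¹' {closedPoint O}) (hYirr : IsIrreducible Y)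
  (hYcl : IsClosed Y) [IsProper q] [IsIntegral P] (hPnoeth : IsLocallyNoetherian P) (hPreg : Scheme.IsRegular P)
  (n : ℕ) [SmoothOfRelativeDimension n q]
  (Ch : ∀ X' : Scheme.{0}, (X' ⟶ P) → Set X' → Prop)
  (hChain : ∀ (X' : Scheme.{0}) (σ : X' ⟶ P) (S : Set X'), Ch X' σ S → Chain P Y X' σ S)
  (hStep : ∀ (X' X'' : Scheme.{0}) (σ' : X' ⟶ P) (S' : Set X') (C : X'.IdealSheafData) (τ : X'' ⟶ X'),
    Ch X' σ' S' → IsBlowup τ C → Scheme.IsRegular C.subscheme → Flat (C.subschemeι ≫ σ' ≫ q) →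
    σ' '' (C.support : Set X') ⊆ {x : P | ¬ IsGenericPoint x Y} →
    (C.support : Set X') ∩ (σ' ≫ q) ⁻¹' {closedPoint O} ⊆ S' →
    Ch X'' (τ ≫ σ') (closure (τ ⁻¹' (S' \ (C.support : Set X')))))
  (Ruled : Tower.RuledDatum P)
  {F₉ : Scheme.{0}} {Z₉ : Set F₉} {hZ₉ : IsClosed Z₉} {F₁₀ : Scheme.{0}} {υ' : F₁₀ ⟶ F₉}
  {G G' : Scheme.{0}} {γ : G ⟶ F₁₀} {T E K : Set G}
  (y : redSub G (closure T) isClosed_closure) (J : G.IdealSheafData) (υ₂ : G' ⟶ G)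
  (hinv : Tower.Inv₁ O k θ P q Y Ch Ruled F₉ Z₉ hZ₉ F₁₀ υ' G γ T E K)
  (hTreg : ¬ IsRegularLocalRing ((redSub G (closure T) isClosed_closure).presheaf.stalk y))
  (hJsupp : (J.support : Set G) = {curvePt G T y})
  (hJgen : ∃ (ℓ : Fin n → G.presheaf.stalk (curvePt G T y))
      (hℓ : ∀ i, ℓ i ∈ maximalIdeal (G.presheaf.stalk (curvePt G T y))),
    stalkIdeal J (curvePt G T y) = Ideal.span (Set.range ℓ) ∧
    LinearIndependent (ResidueField (G.presheaf.stalk (curvePt G T y)))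
      (fun i => (maximalIdeal (G.presheaf.stalk (curvePt G T y))).toCotangent ⟨ℓ i, hℓ i⟩))
  (hυ₂ : IsBlowup υ₂ J)

include hθ hYsp hYirr hYcl hPnoeth hPreg hChain hStep hinv hTreg hJsupp hJgen hυ₂

/-- **THE (pt-ram) STEP ON `Tower.Inv₁`, CONCLUSION (I): `E ↦ υ₂⁻¹{y}`** (see the module docstring). Unconditional: the new plane hosts no
round. [cite: Liu2002, §8.1 and Thm. 8.1.19] [cite: StacksProject, Tag 0805] [OURS · L1 W4.5b · towerPtRam_brick toward
`stub_elnat_ratTowerPointResolution` (stmt-ResolutionOfSingularities-20148 / -20038); NOT a statement of the manuscript] -/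
theorem Tower.inv₁_ptRam_new :
    Tower.Inv₁ O k θ P q Y Ch Ruled F₉ Z₉ hZ₉ F₁₀ υ' G' (υ₂ ≫ γ) (closure (υ₂ ⁻¹' (T \ {curvePt G T y})))
      (υ₂ ⁻¹' {curvePt G T y}) (closure (υ₂ ⁻¹' (K \ {curvePt G T y}))) := by
  classical
  obtain ⟨hυ', hZ₉inf, hGint, hTcl, hTirr, hEcl, hTE, X, σ, S, jG, tG, hCh, hXint, hXnoeth, hXreg, hdom, hsq, hTS, -⟩ := hinv
  haveI := hGint
  haveI := hXint
  haveI := hXnoeth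
  have hyT : curvePt G T y ∈ T := subschemeι_mem_of_isClosed hTcl y
  have hyc : IsClosed ({curvePt G T y} : Set G) := hJsupp ▸ J.support.isClosed
  have hTy : ¬ T ⊆ {curvePt G T y} := not_subset_singleton_of_not_isRegularLocalRing_stalk y hTreg hyc
  haveI : IsClosedImmersion (Spec.map (CommRingCat.ofHom θ)) := IsClosedImmersion.spec_of_surjective _ hθ
  haveI hjci : IsClosedImmersion jG := MorphismProperty.IsStableUnderBaseChange.of_isPullback hsq.flip inferInstance
  have hjyc : IsClosed ({jG (curvePt G T y)} : Set X) := by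
    simpa only [Set.image_singleton] using hjci.isClosedEmbedding.isClosedMap _ hyc
  have hyoff : ¬ IsGenericPoint (σ (jG (curvePt G T y))) Y :=
    not_isGenericPoint_of_image_eq (hChain _ _ _ hCh) jG hjci.isClosedEmbedding.injective hTS hjyc hTy
  obtain ⟨ℓ, hℓ, hJℓ, hli⟩ := hJgen
  obtain ⟨C, X'', τ, j₂, t₂, hτ, -, -, -, -, -, hCh'', hreg'', hnoeth'', hint'', hdom'', -, -, hGnoeth, hG'int, -, hT'irr,
      hsq₂, -, hsets⟩ :=
    fatPointStep_model O k θ hθ P q Y hYsp hYirr hYcl hPnoeth hPreg n Ch hChain hStep X σ S hCh hdom G jG tG hsq T hTS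
      (curvePt G T y) hyT hTy hyoff J hJsupp ℓ hℓ hJℓ hli G' υ₂ hυ₂
  haveI := hGnoeth
  -- `T′ ⊄ υ₂⁻¹{y}`: a point of `T` other than `y` lifts
  have hTE' : ¬ closure (υ₂ ⁻¹' (T \ {curvePt G T y})) ⊆ υ₂ ⁻¹' {curvePt G T y} := by
    obtain ⟨t, htT, htne⟩ := Set.not_subset.mp hTy
    have htJ : t ∉ (J.support : Set G) := by rw [hJsupp]; exact htne
    obtain ⟨t₂, ht₂⟩ := exists_preimage_of_not_mem_support υ₂ J hυ₂ htJ
    intro hsub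
    have h1 : t₂ ∈ closure (υ₂ ⁻¹' (T \ {curvePt G T y})) :=
      subset_closure (by rw [Set.mem_preimage, ht₂]; exact ⟨htT, htne⟩)
    have h2 := hsub h1
    rw [Set.mem_preimage, ht₂] at h2
    exact htne h2
  refine ⟨hυ', hZ₉inf, hG'int, isClosed_closure, hT'irr, hyc.preimage υ₂.continuous, hTE', X'', τ ≫ σ, _, j₂, t₂, hCh'',
    hint'', hnoeth'', hreg'', hdom'', hsq₂, hsets, fun _ => Or.inl ?_⟩
  -- `NoRound`: the new plane lies over the single point `υ' (γ y)` of `F₉`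
  refine (Set.finite_singleton ((γ ≫ υ') (curvePt G T y))).subset ?_
  rintro _ ⟨z, hz, rfl⟩
  rw [Set.mem_preimage, Set.mem_singleton_iff] at hz
  rw [Set.mem_singleton_iff, Scheme.Hom.comp_apply, Scheme.Hom.comp_apply, Scheme.Hom.comp_apply, hz]

/-- **THE (pt-ram) STEP ON `Tower.Inv₁`, CONCLUSION (II): `E ↦ closure υ₂⁻¹(E ∖ {y})`, shadow carried** — under the couplings
«`E` hosts no round ∨ `y ∉ E`» and «`K = ∅ ∨ y ∉ closure K`» and the transport hypothesis `hRuled` for the ruled-surface parameter along a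
point step away from `E` (see the module docstring). [cite: Liu2002, §8.1 and Thm. 8.1.19] [cite: GortzWedhorn2020, Prop. 13.91 (3) and (13.19)]
[cite: StacksProject, Tag 033B] [OURS · L1 W4.5b · towerPtRam_brick toward `stub_elnat_ratTowerPointResolution`; NOT a statement of the manuscript] -/
theorem Tower.inv₁_ptRam_transport
    (hRuled : ∀ (G₀ G₀' : Scheme.{0}) (γ₀ : G₀ ⟶ F₁₀) (E₀ : Set G₀) (X₀ X₀'' : Scheme.{0}) (σ₀ : X₀ ⟶ P) (j₀ : G₀ ⟶ X₀)
        (j₀' : G₀' ⟶ X₀'') (t₀' : G₀' ⟶ Spec (.of k)) (𝓔₀ : X₀.IdealSheafData) (τ₀ : X₀'' ⟶ X₀) (υ₀ : G₀' ⟶ G₀) (y₀ : G₀),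
      j₀' ≫ τ₀ = υ₀ ≫ j₀ → IsPullback j₀' t₀' ((τ₀ ≫ σ₀) ≫ q) (Spec.map (CommRingCat.ofHom θ)) → y₀ ∉ E₀ →
      (∃ e : (𝓔₀.comap τ₀).subscheme ≅ 𝓔₀.subscheme, e.hom ≫ 𝓔₀.subschemeι = (𝓔₀.comap τ₀).subschemeι ≫ τ₀) →
      Ruled F₉ Z₉ hZ₉ F₁₀ υ' G₀ γ₀ E₀ X₀ σ₀ j₀ 𝓔₀ →
      Ruled F₉ Z₉ hZ₉ F₁₀ υ' G₀' (υ₀ ≫ γ₀) (closure (υ₀ ⁻¹' (E₀ \ {y₀}))) X₀'' (τ₀ ≫ σ₀) j₀' (𝓔₀.comap τ₀))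
    (hE : Tower.NoRound υ' G γ E ∨ curvePt G T y ∉ E) (hK : K = ∅ ∨ curvePt G T y ∉ closure K) :
    Tower.Inv₁ O k θ P q Y Ch Ruled F₉ Z₉ hZ₉ F₁₀ υ' G' (υ₂ ≫ γ) (closure (υ₂ ⁻¹' (T \ {curvePt G T y})))
      (closure (υ₂ ⁻¹' (E \ {curvePt G T y}))) (closure (υ₂ ⁻¹' (K \ {curvePt G T y}))) := by
  classical
  obtain ⟨hυ', hZ₉inf, hGint, hTcl, hTirr, hEcl, hTE, X, σ, S, jG, tG, hCh, hXint, hXnoeth, hXreg, hdom, hsq, hTS, hExc⟩ := hinv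
  haveI := hGint
  haveI := hXint
  haveI := hXnoeth
  have hyT : curvePt G T y ∈ T := subschemeι_mem_of_isClosed hTcl y
  have hyc : IsClosed ({curvePt G T y} : Set G) := hJsupp ▸ J.support.isClosed
  have hTy : ¬ T ⊆ {curvePt G T y} := not_subset_singleton_of_not_isRegularLocalRing_stalk y hTreg hyc
  haveI : IsClosedImmersion (Spec.map (CommRingCat.ofHom θ)) := IsClosedImmersion.spec_of_surjective _ hθ
  haveI hjci : IsClosedImmersion jG := MorphismProperty.IsStableUnderBaseChange.of_isPullback hsq.flip inferInstance
  have hjyc : IsClosed ({jG (curvePt G T y)} : Set X) := by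
    simpa only [Set.image_singleton] using hjci.isClosedEmbedding.isClosedMap _ hyc
  have hyoff : ¬ IsGenericPoint (σ (jG (curvePt G T y))) Y :=
    not_isGenericPoint_of_image_eq (hChain _ _ _ hCh) jG hjci.isClosedEmbedding.injective hTS hjyc hTy
  obtain ⟨ℓ, hℓ, hJℓ, hli⟩ := hJgen
  obtain ⟨C, X'', τ, j₂, t₂, hτ, -, -, -, -, hdisj, hCh'', hreg'', hnoeth'', hint'', hdom'', -, -, hGnoeth, hG'int, -, hT'irr,
      hsq₂, hcomm, hsets⟩ :=
    fatPointStep_model O k θ hθ P q Y hYsp hYirr hYcl hPnoeth hPreg n Ch hChain hStep X σ S hCh hdom G jG tG hsq T hTS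
      (curvePt G T y) hyT hTy hyoff J hJsupp ℓ hℓ hJℓ hli G' υ₂ hυ₂
  haveI := hGnoeth
  haveI := hnoeth''
  -- `T′ ⊄ E′`: a point of `T` off `E` and other than `y` lifts
  have hE'sub : closure (υ₂ ⁻¹' (E \ {curvePt G T y})) ⊆ υ₂ ⁻¹' E :=
    closure_minimal (fun z hz => hz.1) (hEcl.preimage υ₂.continuous)
  have hTE' : ¬ closure (υ₂ ⁻¹' (T \ {curvePt G T y})) ⊆ closure (υ₂ ⁻¹' (E \ {curvePt G T y})) := by
    have hex : ∃ t ∈ T, t ∉ E ∧ t ≠ curvePt G T y := by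
      by_contra hcon
      push Not at hcon
      have hsub : T ⊆ E ∪ {curvePt G T y} := fun t ht => by
        by_cases h : t ∈ E
        · exact Or.inl h
        · exact Or.inr (hcon t ht h)
      rcases (isPreirreducible_iff_isClosed_union_isClosed.mp hTirr.isPreirreducible) _ _ hEcl hyc hsub with h | h
      · exact hTE h
      · exact hTy h
    obtain ⟨t, htT, htE, htne⟩ := hex
    have htJ : t ∉ (J.support : Set G) := by rw [hJsupp]; exact htne
    obtain ⟨t₂, ht₂⟩ := exists_preimage_of_not_mem_support υ₂ J hυ₂ htJ
    intro hsub
    have h1 : t₂ ∈ closure (υ₂ ⁻¹' (T \ {curvePt G T y})) :=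
      subset_closure (by rw [Set.mem_preimage, ht₂]; exact ⟨htT, htne⟩)
    have h2 := hE'sub (hsub h1)
    rw [Set.mem_preimage, ht₂] at h2
    exact htE h2
  -- `NoRound` persists along `E ↦ closure υ₂⁻¹(E ∖ {y})`
  have hNR : Tower.NoRound υ' G γ E → Tower.NoRound υ' G' (υ₂ ≫ γ) (closure (υ₂ ⁻¹' (E \ {curvePt G T y}))) := by
    intro hno
    refine hno.subset ?_
    rintro _ ⟨z, hz, rfl⟩
    exact ⟨υ₂ z, hE'sub hz, by rw [Scheme.Hom.comp_apply, Scheme.Hom.comp_apply, Scheme.Hom.comp_apply]⟩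
  refine ⟨hυ', hZ₉inf, hG'int, isClosed_closure, hT'irr, isClosed_closure, hTE', X'', τ ≫ σ, _, j₂, t₂, hCh'', hint'',
    hnoeth'', hreg'', hdom'', hsq₂, hsets, fun hE' => ?_⟩
  rcases hE with hno | hyE
  · exact Or.inl (hNR hno)
  rcases hExc hEcl with hno | ⟨𝓔, he1, he2, he3, he4, he5, hSh⟩
  · exact Or.inl (hNR hno)
  -- the round-ready branch: transport `𝓔` (the centre misses `V(𝓔)` since `y ∉ E`)
  have he1' : 𝓔.comap jG = vanishingIdeal (⟨closure E, isClosed_closure⟩ : Closeds G) := by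
    rw [he1]; congr 1; exact Closeds.ext hEcl.closure_eq.symm
  have hyE' : curvePt G T y ∉ closure E := by rwa [hEcl.closure_eq]
  obtain ⟨hd𝓔, he, -, hregT, hprinc, htrace⟩ := fatPointStep_transport hτ hcomm hυ₂ hJsupp hdisj 𝓔 E he1' hyE'
  refine Or.inr ⟨𝓔.comap τ, htrace, fun z => hprinc z (he2 (τ z)), hregT he3, ?_, ?_, ?_⟩
  · -- (e-iv) the image shrinks
    rintro _ ⟨z, hz, rfl⟩
    have hz' : τ z ∈ (𝓔.support : Set X) := by rw [support_comap] at hz; exact hz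
    rw [Scheme.Hom.comp_apply]
    exact he4 ⟨τ z, hz', rfl⟩
  · -- (e-v) the ruled-surface datum, transported by hypothesis
    exact hRuled G G' γ E X X'' σ jG j₂ t₂ 𝓔 τ υ₂ (curvePt G T y) hcomm hsq₂ hyE he he5
  · -- the cone shadow
    rcases hK with hK0 | hyK
    · left
      rw [hK0, Set.empty_sdiff, Set.preimage_empty, closure_empty]
    rcases hSh with hK0 | ⟨𝒦, hk1, hk2, hk3, hk4⟩
    · left
      rw [hK0, Set.empty_sdiff, Set.preimage_empty, closure_empty]
    obtain ⟨hd𝒦, -, -, -, hprinc𝒦, htrace𝒦⟩ := fatPointStep_transport hτ hcomm hυ₂ hJsupp hdisj 𝒦 K hk2 hyK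
    have htrace𝒦' : (𝒦.comap τ).comap j₂ =
        vanishingIdeal (⟨closure (closure (υ₂ ⁻¹' (K \ {curvePt G T y}))), isClosed_closure⟩ : Closeds G') := by
      rw [htrace𝒦]; congr 1; exact Closeds.ext closure_closure.symm
    refine Or.inr ⟨𝒦.comap τ, fun z => hprinc𝒦 z (hk1 (τ z)), htrace𝒦', ?_, ?_⟩
    · -- (k-iii) flatness through the iso `V((𝓔 ⊔ 𝒦)·𝒪_{X″}) ≅ V(𝓔 ⊔ 𝒦)` over `τ`
      rw [← Scheme.IdealSheafData.comap_sup]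
      have hdEK : Disjoint (((𝓔 ⊔ 𝒦).support : Set X)) (C.support : Set X) :=
        hd𝒦.mono_left (Scheme.IdealSheafData.support_antitone (le_sup_right : 𝒦 ≤ 𝓔 ⊔ 𝒦))
      obtain ⟨e', he'⟩ := exists_iso_subscheme_comap_of_disjoint hτ (𝓔 ⊔ 𝒦) hdEK
      have hfac : ((𝓔 ⊔ 𝒦).comap τ).subschemeι ≫ (τ ≫ σ) ≫ q = e'.hom ≫ ((𝓔 ⊔ 𝒦).subschemeι ≫ σ ≫ q) := by
        rw [← Category.assoc e'.hom, he', Category.assoc, Category.assoc]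
      rw [hfac]
      haveI := hk3
      infer_instance
    · -- (k-iv) conditional regularity, transported
      exact Tower.shadow_conditionalRegularity_transport hτ hcomm hυ₂ hJsupp 𝓔 𝒦 hd𝓔 hd𝒦 hEcl hyE hyK hk2 hk4 hE'

/-- **THE (pt-ram) STEP ON `Tower.Inv₁`, CONCLUSION (II) WITH THE SHADOW FORGOTTEN (`K ↦ ∅`, RULING-5 γ-forget)** — under
«`E` hosts no round ∨ `y ∉ E`» and `hRuled` only. [cite: Liu2002, §8.1 and Thm. 8.1.19] [cite: GortzWedhorn2020, Prop. 13.91 (3)]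
[OURS · L1 W4.5b · towerPtRam_brick toward `stub_elnat_ratTowerPointResolution`; NOT a statement of the manuscript] -/
theorem Tower.inv₁_ptRam_forget
    (hRuled : ∀ (G₀ G₀' : Scheme.{0}) (γ₀ : G₀ ⟶ F₁₀) (E₀ : Set G₀) (X₀ X₀'' : Scheme.{0}) (σ₀ : X₀ ⟶ P) (j₀ : G₀ ⟶ X₀)
        (j₀' : G₀' ⟶ X₀'') (t₀' : G₀' ⟶ Spec (.of k)) (𝓔₀ : X₀.IdealSheafData) (τ₀ : X₀'' ⟶ X₀) (υ₀ : G₀' ⟶ G₀) (y₀ : G₀),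
      j₀' ≫ τ₀ = υ₀ ≫ j₀ → IsPullback j₀' t₀' ((τ₀ ≫ σ₀) ≫ q) (Spec.map (CommRingCat.ofHom θ)) → y₀ ∉ E₀ →
      (∃ e : (𝓔₀.comap τ₀).subscheme ≅ 𝓔₀.subscheme, e.hom ≫ 𝓔₀.subschemeι = (𝓔₀.comap τ₀).subschemeι ≫ τ₀) →
      Ruled F₉ Z₉ hZ₉ F₁₀ υ' G₀ γ₀ E₀ X₀ σ₀ j₀ 𝓔₀ →
      Ruled F₉ Z₉ hZ₉ F₁₀ υ' G₀' (υ₀ ≫ γ₀) (closure (υ₀ ⁻¹' (E₀ \ {y₀}))) X₀'' (τ₀ ≫ σ₀) j₀' (𝓔₀.comap τ₀))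
    (hE : Tower.NoRound υ' G γ E ∨ curvePt G T y ∉ E) :
    Tower.Inv₁ O k θ P q Y Ch Ruled F₉ Z₉ hZ₉ F₁₀ υ' G' (υ₂ ≫ γ) (closure (υ₂ ⁻¹' (T \ {curvePt G T y})))
      (closure (υ₂ ⁻¹' (E \ {curvePt G T y}))) ∅ := by
  have h := Tower.inv₁_ptRam_transport O k θ hθ P q Y hYsp hYirr hYcl hPnoeth hPreg n Ch hChain hStep Ruled y J υ₂
    (K := ∅) ?_ hTreg hJsupp hJgen hυ₂ hRuled hE (Or.inl rfl)
  · simpa only [Set.empty_sdiff, Set.preimage_empty, closure_empty] using h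
  · -- `Tower.Inv₁` does not see `K` outside `Tower.Shadow`, where `K = ∅` is the forgotten case
    obtain ⟨hυ', hZ₉inf, hGint, hTcl, hTirr, hEcl, hTE, X, σ, S, jG, tG, hCh, hXint, hXnoeth, hXreg, hdom, hsq, hTS, hExc⟩ := hinv
    refine ⟨hυ', hZ₉inf, hGint, hTcl, hTirr, hEcl, hTE, X, σ, S, jG, tG, hCh, hXint, hXnoeth, hXreg, hdom, hsq, hTS, fun hE' => ?_⟩
    rcases hExc hE' with hno | ⟨𝓔, he1, he2, he3, he4, he5, -⟩
    · exact Or.inl hno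
    · exact Or.inr ⟨𝓔, he1, he2, he3, he4, he5, Or.inl rfl⟩

end PtRam

end Summit.ResolutionOfSingularities.ResolutionOfSingularities.Cruxes.EquisingularLiftNat.Sections

end
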